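import Summits.FinalStateConjecture.FinalStateConjecture.Theses.StarvedNecks

/-!
# `stub_rim` of line `wide-anchoring` (generation 2) — candidate proof (drefute seat)

Crux `StarvedNecks.SeamedChartsExhaust` (stmt-FinalStateConjecture-13551). The statement below is
VERBATIM the registered stub `stub_rim` of `Cruxes/SeamedChartsExhaust/Lines/wide-anchoring.lean`
(= `Lines/rim-criterion.lean`'s `stub_rim`). Pure closure bookkeeping, no causal content:
`closure F = closure F₀ ∪ ⋃ⱼ closure Fⱼ` (finite union); flat part by SEAMED (11) at `τ' = τ₁`
(flat point with `y⁰ ≥ τ₁`: `> τ₁` is in `F`, `= τ₁` is the flat slab; wall point `Ψⱼ x`, `x⁰ ≥ τ₁`,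
`rⱼ x = ρⱼ(x⁰) ≥ R₀` by `h1`, `rⱼ + 2 ≤ Rⱼ(tⱼ x)` by SEAMED (8): `tⱼ > τ₁` in `Fⱼ`, else ride-able via
the flat-late disjunct `τ₀ ≤ x⁰`); hole part by HonestCore (c) with the continuous profile `ϱ := Rᵢ`
(`t > τ₁`: in `Fᵢ`; `t = τ₁`: hole disc of the certified slab). Clauses consumed: `hcl`, `h1`
(continuity of `Rᵢ` only to feed `hcl`; `R₀ ≤ ρᵢ`), `h8`, `h11`. O'Neill 1983, Ch. 14, p. 403.
-/

noncomputable section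

open Set Filter Topology Function TopologicalSpace
open scoped Manifold ContDiff ENNReal Topology
open Literature.Geometry.Lorentzian

namespace Summit.FinalStateConjecture.FinalStateConjecture.Cruxes.SeamedChartsExhaust.DRefute

set_option linter.dupNamespace false

/-- **RIM ENUMERATION** (`wide-anchoring` g2 / `rim-criterion` `stub_rim`, verbatim signature):
every point of `O` in the closure of the certified late region after `τ₁` but not in it lies on the
certified slab at `τ₁` or is a ride-able certified tube point (hole time `≤ τ₁`, `R₀ ≤ rⱼ ≤ Rⱼ(tⱼ)`,
hole-late or flat-late). O'Neill 1983, Ch. 14, p. 403. [folklore] -/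
theorem stub_rim (𝓢 : Spacetime.{0} 4) (O : Set 𝓢.carrier) (d : FinalStateDecomposition 𝓢 O 2)
    (R : Fin d.N → ℝ → ℝ) (R₀ : ℝ)
    (hcl : ∀ i (τ' : ℝ) (ϱ : ℝ → ℝ), Continuous ϱ → d.τ₀ < τ' →
      closure (d.chart i '' {x | τ' ≤ (d.background i).time x.1 ∧
        (d.background i).radius x.1 ≤ ϱ ((d.background i).time x.1)}) ∩ O ⊆
      d.chart i '' {x | τ' ≤ (d.background i).time x.1 ∧
        (d.background i).radius x.1 ≤ ϱ ((d.background i).time x.1)})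
    (h1 : ∀ i, Continuous (R i) ∧ ∀ s, R₀ ≤ d.excision i s)
    (h8 : ∀ j (y : E4), d.τ₀ ≤ y 0 → (d.background j).radius y ≤ d.excision j (y 0) →
      (d.background j).radius y + 2 ≤ R j ((d.background j).time y))
    (h11 : ∀ τ' : ℝ, d.τ₀ < τ' → closure (d.flatChart '' {y | τ' ≤ y.1 0}) ⊆
      d.flatChart '' {y | τ' ≤ y.1 0} ∪
        ⋃ j, d.chart j '' {x | τ' ≤ x.1 0 ∧ (d.background j).radius x.1 = d.excision j (x.1 0)})
    (τ₁ : ℝ) (hτ₁ : d.τ₀ < τ₁) :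
    (closure (certifiedLate d R τ₁) ∩ O) \ certifiedLate d R τ₁ ⊆
      certifiedSlab d R τ₁ ∪ ⋃ j, d.chart j '' {x | (d.τ₀ ≤ (d.background j).time x.1 ∨ d.τ₀ ≤ x.1 0) ∧
        R₀ ≤ (d.background j).radius x.1 ∧
        (d.background j).radius x.1 ≤ R j ((d.background j).time x.1) ∧
        (d.background j).time x.1 ≤ τ₁} := by
  rintro z ⟨⟨hzcl, hzO⟩, hzF⟩
  -- the closure of the finite union splits
  have hsplit : z ∈ closure (d.flatChart '' (Minkowski.backgroundOn d.flatDomain).lateRegion τ₁) ∪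
      ⋃ i, closure (d.chart i '' {x | τ₁ < (d.background i).time x.1 ∧
        (d.background i).radius x.1 ≤ R i ((d.background i).time x.1)}) := by
    have h := hzcl
    rw [certifiedLate, closure_union, closure_iUnion_of_finite] at h
    exact h
  rcases hsplit with hz0 | hzU
  · -- flat part: SEAMED (11) at `τ' = τ₁`
    have hsub : d.flatChart '' (Minkowski.backgroundOn d.flatDomain).lateRegion τ₁ ⊆
        d.flatChart '' {y | τ₁ ≤ y.1 0} := by
      rintro _ ⟨y, hy, rfl⟩
      exact ⟨y, le_of_lt (show τ₁ < y.1 0 from hy), rfl⟩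
    rcases h11 τ₁ hτ₁ (closure_mono hsub hz0) with ⟨y, hy, rfl⟩ | hwall
    · -- a flat point with `y⁰ ≥ τ₁`
      rcases (show τ₁ ≤ y.1 0 from hy).eq_or_lt with heq | hlt
      · exact Or.inl (Or.inl ⟨y, heq.symm, rfl⟩)
      · exact (hzF (Or.inl ⟨y, hlt, rfl⟩)).elim
    · -- a flat-tube wall point `Ψⱼ x`, `x⁰ ≥ τ₁`, `rⱼ x = ρⱼ(x⁰)`
      obtain ⟨j, hj⟩ := mem_iUnion.mp hwall
      obtain ⟨x, ⟨hx0, hxr⟩, rfl⟩ := hj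
      have hx0 : τ₁ ≤ x.1 0 := hx0
      have hxr : (d.background j).radius x.1 = d.excision j (x.1 0) := hxr
      have hτ₀x : d.τ₀ ≤ x.1 0 := by linarith
      have hR₀ : R₀ ≤ (d.background j).radius x.1 := by
        rw [hxr]
        exact (h1 j).2 _
      have h8x : (d.background j).radius x.1 + 2 ≤ R j ((d.background j).time x.1) :=
        h8 j x.1 hτ₀x hxr.le
      have hrR : (d.background j).radius x.1 ≤ R j ((d.background j).time x.1) := by linarith
      rcases le_or_gt ((d.background j).time x.1) τ₁ with hle | hgt
      · exact Or.inr (mem_iUnion.mpr ⟨j, x, ⟨Or.inr hτ₀x, hR₀, hrR, hle⟩, rfl⟩)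
      · exact (hzF (Or.inr (mem_iUnion.mpr ⟨j, x, ⟨hgt, hrR⟩, rfl⟩))).elim
  · -- hole part: HonestCore (c) with the continuous profile `ϱ := Rᵢ`
    obtain ⟨i, hzi⟩ := mem_iUnion.mp hzU
    have hsub : d.chart i '' {x | τ₁ < (d.background i).time x.1 ∧
        (d.background i).radius x.1 ≤ R i ((d.background i).time x.1)} ⊆
        d.chart i '' {x | τ₁ ≤ (d.background i).time x.1 ∧
          (d.background i).radius x.1 ≤ R i ((d.background i).time x.1)} := by
      rintro _ ⟨x, ⟨hxt, hxr⟩, rfl⟩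
      exact ⟨x, ⟨hxt.le, hxr⟩, rfl⟩
    obtain ⟨x, ⟨hxt, hxr⟩, rfl⟩ := hcl i τ₁ (R i) (h1 i).1 hτ₁ ⟨closure_mono hsub hzi, hzO⟩
    have hxt : τ₁ ≤ (d.background i).time x.1 := hxt
    have hxr : (d.background i).radius x.1 ≤ R i ((d.background i).time x.1) := hxr
    rcases hxt.eq_or_lt with heq | hlt
    · refine Or.inl (Or.inr (mem_iUnion.mpr ⟨i, x, ⟨heq.symm, ?_⟩, rfl⟩))
      show (d.background i).radius x.1 ≤ R i τ₁
      rw [heq]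
      exact hxr
    · exact (hzF (Or.inr (mem_iUnion.mpr ⟨i, x, ⟨hlt, hxr⟩, rfl⟩))).elim

end Summit.FinalStateConjecture.FinalStateConjecture.Cruxes.SeamedChartsExhaust.DRefute

end
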